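import Mathlib
import Summits.Ventures.PercRepro2.Defs
import Summits.Ventures.PercRepro2.Graph

/-!
# Pendant pruning — the definition (mine-a g5; MINE-A.md §25, §35)

`RB.Prunable ends s t b o w p`: the weight vector `p` reduces, by repeatedly giving weight `0` to
the single nonzero-weight edge of an unmarked pendant vertex `u ∉ {s, t, b, o, w}` (a non-loop),
to a weight vector all of whose nonzero-weight edges at `w` end in `{s, t, b, o}`. This is the
class «`N⁺(w) ⊆ {s, t, b, o}` after pruning pendant unmarked trees» of the paper's §25 reduction
(parallel edges need no pruning: `RBParallel`); the typed row 2′RB is a theorem on it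
(`RB.RBcross_and_RBsame_of_prunable`, RBKernelLeaf.lean).
-/

namespace Summit.Ventures.PercRepro2

namespace RB

/-- `p` reduces by pendant pruning to «every nonzero-weight edge at `w` ends in `{s, t, b, o}`». -/
inductive Prunable {V : Type*} {E : Type*} (ends : E → Sym2 V) (s t b o w : V) {R : Type*} [Zero R]
    [DecidableEq E] : (E → R) → Prop
  /-- The kernel class: every nonzero-weight edge at `w` ends in `{s, t, b, o}`. -/
  | kernel (p : E → R)
      (H : ∀ e, w ∈ ends e → p e ≠ 0 →
        ends e = s(w, s) ∨ ends e = s(w, t) ∨ ends e = s(w, b) ∨ ends e = s(w, o)) :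
      Prunable ends s t b o w p
  /-- Pruning an unmarked pendant vertex `u` (its single nonzero-weight edge `f = {u, v}`, `v ≠ u`). -/
  | prune (p : E → R) (f : E) (u v : V) (hends : ends f = s(u, v)) (hvu : v ≠ u) (hus : u ≠ s)
      (hut : u ≠ t) (hub : u ≠ b) (huo : u ≠ o) (huw : u ≠ w)
      (huniq : ∀ e, u ∈ ends e → p e ≠ 0 → e = f)
      (h : Prunable ends s t b o w (Function.update p f 0)) :
      Prunable ends s t b o w p

end RB

end Summit.Ventures.PercRepro2
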